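import Literature.MathematicalPhysics.KineticTheory.CollisionFluxUpperBound
import Literature.MathematicalPhysics.KineticTheory.HardSphereCanonicalPairBound
import Literature.MathematicalPhysics.KineticTheory.CollisionTailMarks
import Summits.AtomisticToContinuum.HydrodynamicLimit.Theorems.JParityClosureCollisionTightnessSweptTube
import Summits.AtomisticToContinuum.HydrodynamicLimit.Theorems.JParityClosureCollisionTightnessTorusGibbs
import Summits.AtomisticToContinuum.HydrodynamicLimit.Theorems.JParityClosureOddContactSymmetryGibbsInvariance
import HarnessLib

/-!
# Crux `JParityClosure.EvenStressEnskog` (stmt-AtomisticToContinuum-13079), line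
# `even-rung-mean-variance`: helper stub `stub_velocityTailCollisionSumRung0` ((H_K) at rung 0)

At RUNG 0 (constant profiles: the local Gibbs law is the homogeneous canonical Gibbs law `G_N`,
stationary under every hard-sphere flow, `measurePreserving_flow_localGibbsLaw_const`) the collision
sum of the SPEED-TAIL mark `m_L(n, v, w) = ‖w − v‖(1 − ψ_L(‖w − v‖))` (`speedTailMark L`, the collision
side of the velocity-truncation error of the line) is small in `G_N`-probability, uniformly in `N`,
once `L` is large: `G_N{η < K_N[g m_L]} ≤ δ` for `L ≥ L₀(a, u, θ, σ, τ, g, η, δ)` and all `N ≥ 1`.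

Proof.  Pathwise, `K_N[g m_L](z) ≤ ε/(N+1) · sup g · Σ_{collisions} a_L(vᵢ, vⱼ)` with
`a_L(v, w) = ‖w − v‖(1 − ψ_L(‖w − v‖))` read on the post-collisional velocities
(`collisionSum_speedTailMark_le`: the mark only sees the modulus of the relative velocity, which the
elastic reflection preserves; `g` is continuous with `g = 0` beyond `ηK`, hence bounded on `[0, ∞)`,
and its argument `σ³ρ_r ≥ 0`).  The collision-flux upper bound
`localGibbsLaw_collisionMarkSum_ge_le` of `Literature/…/CollisionFluxUpperBound` (Markov + stationarity
+ Fatou over a time grid + the static one-window bound), fed with the swept collision tube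
(`exists_sweptTube`), the minimal-image lift inequality
(`volume_setOf_exists_reprSym_add_latticeVec_mem_le`) and the Ruelle-type pair bound
(`posGibbs_pairEvent_le`, small reduced density), gives
`G_N{Σ a_L ≥ η'} ≤ η'⁻¹ · 16 τ (N+1)² ε² ∫ ‖w − v‖ a_L dN(u,θ)^{⊗2}`; and
`‖w − v‖ a_L(v, w) = ‖w − v‖²(1 − ψ_L) ≤ 4 t_L(v) + 4 t_L(w)` (`sq_mul_one_sub_speedCutoff_le`) bounds
the Gaussian integral by `8 · gaussVelTail u θ L → 0` (`tendsto_gaussVelTail`).  With `(N+1) ε³ = σ³`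
the bound is `128 · sup g · τ σ³ η⁻¹ · gaussVelTail u θ L`, uniformly in `N ≥ 1`.

References: C. Cercignani, R. Illner, M. Pulvirenti, *The Mathematical Theory of Dilute Gases*
(1994), App. 4.A; I. Gallagher, L. Saint-Raymond, B. Texier, *From Newton to Boltzmann* (2013),
Prop. 4.1.1; H. Spohn, *Large Scale Dynamics of Interacting Particles* (1991), Part I §2.3.
-/

noncomputable section

open MeasureTheory Set Filter Topology
open scoped ENNReal InnerProductSpace BigOperators

namespace Summit.AtomisticToContinuum.HydrodynamicLimit.Theorems.EvenStressEnskog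

open Literature.Analysis.FluidPDE Literature.MathematicalPhysics.KineticTheory

/-! ### The speed-tail mark -/

/-- The speed-tail mark at a collision only sees the modulus of the relative velocity, which the
reflection preserves: `m_L(n̂, v⁻, w⁻) = ‖w − v‖(1 − ψ_L(‖w − v‖))`. [folklore] -/
theorem speedTailMark_reflectVel (L : ℝ) (nhat n : V3) (p : V3 × V3) :
    speedTailMark L (nhat, (reflectVel n p).1, (reflectVel n p).2) =
      ‖p.2 - p.1‖ * (1 - speedCutoff L ‖p.2 - p.1‖) := by
  unfold speedTailMark
  rw [norm_snd_sub_fst_reflectVel]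

/-- **The Gaussian integral of the flux-weighted speed tail**:
`∫ ‖w − v‖ · ‖w − v‖(1 − ψ_L(‖w − v‖)) dN(u,θ)(v) dN(u,θ)(w) ≤ 8 · gaussVelTail u θ L` (`0 < L`;
`‖w − v‖²(1 − ψ_L) ≤ 4 t_L(v) + 4 t_L(w)`). [folklore] -/
theorem lintegral_speedTail_flux_le {L : ℝ} (hL : 0 < L) (u : V3) (θ : ℝ) :
    ∫⁻ p, ENNReal.ofReal (‖p.2 - p.1‖ * (‖p.2 - p.1‖ * (1 - speedCutoff L ‖p.2 - p.1‖)))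
        ∂((gaussMeasure u θ).prod (gaussMeasure u θ)) ≤ 8 * gaussVelTail u θ L := by
  set γ := gaussMeasure u θ with hγ
  have hmv : Measurable fun v : V3 => ENNReal.ofReal (velTail L v) := (measurable_velTail L).ennreal_ofReal
  have hm1 : Measurable fun p : V3 × V3 => ENNReal.ofReal (velTail L p.1) := hmv.comp measurable_fst
  have hm2 : Measurable fun p : V3 × V3 => ENNReal.ofReal (velTail L p.2) := hmv.comp measurable_snd
  have hle : ∀ p : V3 × V3, ENNReal.ofReal (‖p.2 - p.1‖ * (‖p.2 - p.1‖ * (1 - speedCutoff L ‖p.2 - p.1‖))) ≤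
      4 * ENNReal.ofReal (velTail L p.1) + 4 * ENNReal.ofReal (velTail L p.2) := by
    intro p
    have h := sq_mul_one_sub_speedCutoff_le hL p.1 p.2
    calc ENNReal.ofReal (‖p.2 - p.1‖ * (‖p.2 - p.1‖ * (1 - speedCutoff L ‖p.2 - p.1‖)))
        ≤ ENNReal.ofReal (4 * velTail L p.1 + 4 * velTail L p.2) :=
          ENNReal.ofReal_le_ofReal (by rw [← mul_assoc, ← sq]; exact h)
      _ = 4 * ENNReal.ofReal (velTail L p.1) + 4 * ENNReal.ofReal (velTail L p.2) := by
          rw [ENNReal.ofReal_add (by linarith [velTail_nonneg L p.1]) (by linarith [velTail_nonneg L p.2]),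
            ENNReal.ofReal_mul (by norm_num), ENNReal.ofReal_mul (by norm_num), ENNReal.ofReal_ofNat]
  have h1 : ∫⁻ p, ENNReal.ofReal (velTail L p.1) ∂(γ.prod γ) = gaussVelTail u θ L := by
    calc ∫⁻ p, ENNReal.ofReal (velTail L p.1) ∂(γ.prod γ)
        = ∫⁻ v, ∫⁻ _w, ENNReal.ofReal (velTail L v) ∂γ ∂γ := lintegral_prod _ hm1.aemeasurable
      _ = ∫⁻ v, ENNReal.ofReal (velTail L v) ∂γ := by simp only [lintegral_const, measure_univ, mul_one]
      _ = gaussVelTail u θ L := rfl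
  have h2 : ∫⁻ p, ENNReal.ofReal (velTail L p.2) ∂(γ.prod γ) = gaussVelTail u θ L := by
    calc ∫⁻ p, ENNReal.ofReal (velTail L p.2) ∂(γ.prod γ)
        = ∫⁻ _v, ∫⁻ w, ENNReal.ofReal (velTail L w) ∂γ ∂γ := lintegral_prod _ hm2.aemeasurable
      _ = ∫⁻ _v, gaussVelTail u θ L ∂γ := rfl
      _ = gaussVelTail u θ L := by simp only [lintegral_const, measure_univ, mul_one]
  calc ∫⁻ p, ENNReal.ofReal (‖p.2 - p.1‖ * (‖p.2 - p.1‖ * (1 - speedCutoff L ‖p.2 - p.1‖))) ∂(γ.prod γ)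
      ≤ ∫⁻ p, (4 * ENNReal.ofReal (velTail L p.1) + 4 * ENNReal.ofReal (velTail L p.2)) ∂(γ.prod γ) :=
        lintegral_mono hle
    _ = 4 * gaussVelTail u θ L + 4 * gaussVelTail u θ L := by
        rw [lintegral_add_left (hm1.const_mul _), lintegral_const_mul _ hm1, lintegral_const_mul _ hm2,
          h1, h2]
    _ = 8 * gaussVelTail u θ L := by rw [← add_mul]; norm_num

/-! ### The collision sum of the speed-tail mark is dominated by the collision sum of `a_L` -/

/-- **Pathwise domination.** On a good orbit, the collision sum `K_N[g m_L]` (cutoff `χ ≡ 1`) is at most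
`ε/(N+1) · C · Σ_{collisions} a_L(vᵢ, vⱼ)` whenever `g ≤ C` on `[0, ∞)` (`0 < r`, so that the
mollified density is nonnegative), `a_L(v, w) = ‖w − v‖(1 − ψ_L(‖w − v‖))` being read on the
right-continuous (post-collisional) velocities. [folklore] -/
theorem collisionSum_speedTailMark_le {σ : ℝ} (hσ : 0 < σ) {N : ℕ}
    (Φ : HardSphereFlow (Torus.geometry (Fin 3)) (hsDiameter σ N) (N + 1)) (τ : ℝ) {g : ℝ → ℝ} {C : ℝ}
    (hgC : ∀ x, 0 ≤ x → g x ≤ C) (L : ℝ) {r : ℝ} (hr : 0 < r) {z : Config (N + 1) (Fin 3) T3}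
    (hz : z ∈ Φ.good) :
    collisionSum σ N Φ τ (fun _ => 1) g (speedTailMark L) r z ≤
      hsDiameter σ N / (N + 1 : ℝ) * C *
        ∑ᶠ s ∈ collisionTimes (Torus.geometry (Fin 3)) (hsDiameter σ N) (fun t => Φ.flow t z) ∩ Icc 0 τ,
          ∑ i : Fin (N + 1), ∑ j : Fin (N + 1),
            (if i ≠ j ∧ ‖(Torus.geometry (Fin 3)).sepVec (Φ.flow s z i).1 (Φ.flow s z j).1‖ = hsDiameter σ N
              then ‖(Φ.flow s z j).2 - (Φ.flow s z i).2‖ *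
                (1 - speedCutoff L ‖(Φ.flow s z j).2 - (Φ.flow s z i).2‖) else 0) := by
  have hfin := (Φ.isTrajectory z hz).locFinite 0 τ
  have hε : 0 ≤ hsDiameter σ N / (N + 1 : ℝ) := div_nonneg (hsDiameter_pos hσ N).le (by positivity)
  dsimp only [collisionSum]
  rw [finsum_mem_eq_finite_toFinset_sum _ hfin, finsum_mem_eq_finite_toFinset_sum _ hfin,
    mul_assoc (hsDiameter σ N / (N + 1 : ℝ)) C]
  refine mul_le_mul_of_nonneg_left ?_ hε
  rw [Finset.mul_sum]
  refine Finset.sum_le_sum fun s _ => ?_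
  rw [Finset.mul_sum]
  refine Finset.sum_le_sum fun i _ => ?_
  rw [Finset.mul_sum]
  refine Finset.sum_le_sum fun j _ => ?_
  by_cases hc : i ≠ j ∧ ‖(Torus.geometry (Fin 3)).sepVec (Φ.flow s z i).1 (Φ.flow s z j).1‖ = hsDiameter σ N
  · rw [if_pos hc, if_pos hc, speedTailMark_reflectVel, one_mul]
    refine mul_le_mul_of_nonneg_right (hgC _ ?_) (mul_nonneg (norm_nonneg _)
      (sub_nonneg.2 (speedCutoff_mem_Icc L _).2))
    exact mul_nonneg (pow_nonneg hσ.le 3) (integral_nonneg fun q =>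
      mul_nonneg (div_nonneg (by norm_num) (by positivity)) (le_max_right _ _))
  · rw [if_neg hc, if_neg hc, mul_zero]

/-! ### The stub -/

/-- **Registered helper stub `stub_velocityTailCollisionSumRung0`** ((H_K) at rung 0) of the line
`even-rung-mean-variance` of crux stmt-AtomisticToContinuum-13079: under the rung-0 (homogeneous) Gibbs
law the collision sum of the speed-tail mark `m_L` (cutoff `χ ≡ 1`, Enskog factor `g` continuous,
nonnegative and vanishing beyond `ηK`) exceeds `η` with probability at most `δ`, for all `L ≥ L₀`
and all `N ≥ N₀`, `L₀` and `N₀ = 1` NOT depending on `N` (collision-flux upper bound + Gaussian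
velocity tails). [folklore] -/
theorem stub_velocityTailCollisionSumRung0 : ∃ ηK : ℝ, 0 < ηK ∧ ∀ (a θ : ℝ) (u : V3), 0 < a → 0 < θ → ∃ σ₀ : ℝ, 0 < σ₀ ∧ ∀ σ : ℝ, 0 < σ → σ < σ₀ → ∀ Φ : (N : ℕ) → HardSphereFlow (Torus.geometry (Fin 3)) (hsDiameter σ N) (N + 1), ∀ τ : ℝ, 0 < τ → ∀ g : ℝ → ℝ, Continuous g → (∀ b, ηK ≤ b → g b = 0) → (∀ b, 0 ≤ g b) → ∀ η δ : ℝ, 0 < η → 0 < δ → ∃ r₀ : ℝ, 0 < r₀ ∧ ∀ r : ℝ, 0 < r → r < r₀ → ∃ L₀ : ℝ, ∀ L : ℝ, L₀ ≤ L → ∃ N₀ : ℕ, ∀ N : ℕ, N₀ ≤ N → localGibbsLaw σ (fun _ => a) (fun _ => u) (fun _ => θ) N (Φ N) {z | η < collisionSum σ N (Φ N) τ (fun _ => 1) g (speedTailMark L) r z} ≤ ENNReal.ofReal δ := by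
  refine ⟨1, one_pos, fun a θ u ha hθ => ?_⟩
  obtain ⟨σ₀, hσ₀, hsmall⟩ := exists_smallDensity uniformProfile one_pos
  refine ⟨σ₀, hσ₀, fun σ hσ hσlt Φ τ hτ g hg hg1 _ η δ hη hδ => ?_⟩
  have hsm : SmallDensity uniformProfile σ := (hsmall σ hσ hσlt).1
  obtain ⟨Cg, hCg0, hCg⟩ := exists_bound_of_cutoff hg hg1
  set C₁ : ℝ := Cg + 1 with hC₁
  have hC₁0 : 0 < C₁ := by rw [hC₁]; linarith
  have hgC : ∀ x, 0 ≤ x → g x ≤ C₁ := fun x hx => (hCg x hx).trans (by rw [hC₁]; linarith)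
  refine ⟨1, one_pos, fun r hr _ => ?_⟩
  -- the Gaussian tail target
  set cR : ℝ := δ * η / (128 * C₁ * τ * σ ^ 3) with hcR
  have hcR0 : 0 < cR := by rw [hcR]; positivity
  have hev : ∀ᶠ L in atTop, gaussVelTail u θ L < ENNReal.ofReal cR :=
    (tendsto_order.1 (tendsto_gaussVelTail u θ)).2 _ (ENNReal.ofReal_pos.2 hcR0)
  obtain ⟨L₁, hL₁⟩ := eventually_atTop.1 hev
  refine ⟨max L₁ 1, fun L hL => ⟨1, fun N hN => ?_⟩⟩
  have hL1 : L₁ ≤ L := (le_max_left _ _).trans hL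
  have hL0 : 0 < L := zero_lt_one.trans_le ((le_max_right _ _).trans hL)
  -- notation
  set ε := hsDiameter σ N with hεdef
  have hε : 0 < ε := hsDiameter_pos hσ N
  set P := localGibbsLaw σ (fun _ => a) (fun _ => u) (fun _ => θ) N (Φ N) with hP
  set b : V3 × V3 → ℝ := fun p => ‖p.2 - p.1‖ * (1 - speedCutoff L ‖p.2 - p.1‖) with hb
  have hbm : Measurable b := by
    rw [hb]; unfold speedCutoff; fun_prop
  have hb0 : ∀ p, 0 ≤ b p := fun p => mul_nonneg (norm_nonneg _) (sub_nonneg.2 (speedCutoff_mem_Icc L _).2)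
  set Mu : ℝ := ε / (N + 1 : ℝ) * C₁ with hMu
  have hMu0 : 0 < Mu := by rw [hMu]; positivity
  set η' : ℝ := η / Mu with hη'
  have hη'0 : 0 < η' := div_pos hη hMu0
  -- the event of a large `a_L`-collision sum on the good set
  set B : Set (Config (N + 1) (Fin 3) T3) := {z | z ∈ (Φ N).good ∧ η' ≤
      ∑ᶠ s ∈ collisionTimes (Torus.geometry (Fin 3)) ε (fun t => (Φ N).flow t z) ∩ Icc 0 τ,
        ∑ i : Fin (N + 1), ∑ j : Fin (N + 1),
          (if i ≠ j ∧ ‖(Torus.geometry (Fin 3)).sepVec ((Φ N).flow s z i).1 ((Φ N).flow s z j).1‖ = ε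
            then b (((Φ N).flow s z i).2, ((Φ N).flow s z j).2) else 0)} with hB
  have hsub : {z | η < collisionSum σ N (Φ N) τ (fun _ => 1) g (speedTailMark L) r z} ⊆ (Φ N).goodᶜ ∪ B := by
    intro z hz
    by_cases hgood : z ∈ (Φ N).good
    · refine Or.inr ⟨hgood, ?_⟩
      have h1 := collisionSum_speedTailMark_le hσ (Φ N) τ hgC L hr hgood
      have h2 : η < Mu * _ := lt_of_lt_of_le hz h1
      rw [hη']
      exact (div_le_iff₀' hMu0).2 h2.le
    · exact Or.inl hgood
  have hgood0 : P (Φ N).goodᶜ = 0 := by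
    rw [hP, localGibbsLaw_eq]
    exact localGibbsMeasure_absolutelyContinuous σ _ _ _ N (Φ N) (Φ N).measure_compl_good
  have hBle := localGibbsLaw_collisionMarkSum_ge_le hsm.σ_lt_half.le ha hθ u (Φ N)
    (measurePreserving_flow_localGibbsLaw_const σ a θ u N (Φ N))
    (fun i j hij T hT => posGibbs_pairEvent_le hsm hN hij hT)
    (fun h hh => exists_sweptTube (hsDiameter_pos hσ N) hh)
    (fun S hS => by simpa only [sub_zero] using volume_setOf_exists_reprSym_add_latticeVec_mem_le 0 hS)
    hτ hbm hb0 hη'0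
  have hI : ∫⁻ p, ENNReal.ofReal (‖p.2 - p.1‖ * b p) ∂((gaussMeasure u θ).prod (gaussMeasure u θ)) ≤
      8 * ENNReal.ofReal cR :=
    (lintegral_speedTail_flux_le hL0 u θ).trans (by gcongr; exact (hL₁ L hL1).le)
  -- the arithmetic of the constants
  have hkey : η'⁻¹ * (16 * τ * ((N + 1 : ℕ) : ℝ) ^ 2 * ε ^ 2) * (8 * cR) = δ := by
    have hε3 : ((N + 1 : ℕ) : ℝ) * ε ^ 3 = σ ^ 3 := succ_mul_hsDiameter_pow_three σ N
    rw [hη', hMu, hcR, ← hε3]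
    push_cast
    field_simp
    ring
  calc P {z | η < collisionSum σ N (Φ N) τ (fun _ => 1) g (speedTailMark L) r z}
      ≤ P ((Φ N).goodᶜ ∪ B) := measure_mono hsub
    _ ≤ P (Φ N).goodᶜ + P B := measure_union_le _ _
    _ ≤ 0 + (ENNReal.ofReal η')⁻¹ * (ENNReal.ofReal (16 * τ * ((N + 1 : ℕ) : ℝ) ^ 2 * ε ^ 2) *
          (8 * ENNReal.ofReal cR)) := by
        rw [hgood0]
        refine add_le_add le_rfl (hBle.trans ?_)
        gcongr
    _ = ENNReal.ofReal (η'⁻¹ * (16 * τ * ((N + 1 : ℕ) : ℝ) ^ 2 * ε ^ 2) * (8 * cR)) := by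
        rw [zero_add, ← ENNReal.ofReal_inv_of_pos hη'0, ← ENNReal.ofReal_ofNat 8,
          ← ENNReal.ofReal_mul (by norm_num), ← ENNReal.ofReal_mul (by positivity),
          ← ENNReal.ofReal_mul (by positivity)]
        congr 1
        ring
    _ = ENNReal.ofReal δ := by rw [hkey]

end Summit.AtomisticToContinuum.HydrodynamicLimit.Theorems.EvenStressEnskog

end
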